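import Mathlib
import Literature.NumberTheory.Sieve.LargeGapsBetweenPrimes
import Literature.NumberTheory.Sieve.LargeGapsErdosProofs
import Literature.NumberTheory.Sieve.RankinSmoothBound
import Literature.NumberTheory.LFunctions.RHWave0PNTProofs
import HarnessLib

/-!
# Rankin's 1938 large-gap theorem `G(X) ≫ log X · log₂ X · log₄ X / (log₃ X)²` — PROVED

Topic `Literature/NumberTheory/Sieve`. PROOF FILE (theorems only): we discharge the named fact
`Literature.NumberTheory.Sieve.Rankin1938_existsConstant` of `LargeGapsBetweenPrimes.lean`
(`rankin1938_existsConstant_holds : ∃ c > 0, RankinConstant c`, with the admissible — far from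
optimal — constant `c = 1/21504`), i.e. Montgomery–Vaughan's Theorem 7.15, by the Erdős–Rankin
method exactly as in `LargeGapsErdosProofs.lean` but with Rankin's choice of the length parameter,
`L = ⌊log z · log₃ z/(672 (log₂ z)²)⌋` (MV take `L = log z · log₃ z/(4 (log₂ z)²)`; the `672` pays for
the Chebyshev–Mertens-quality constants of the tree's smooth-number bound), `K = 2L + 1`,
`M = K^{24L}` and Rankin's exponent `η = 7 log₂ z/log z`.

DISCLOSURE ON THE FORM OF THE STATEMENT. Montgomery–Vaughan display Theorem 7.15 as
`limsup (p_{n+1} − p_n)/(log p_n · log₂ p_n · log₄ p_n/(log₃ p_n)²) ≥ c`; the tree's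
`RankinConstant c` (`∀ ε > 0`, for all large `X` there are consecutive primes `≤ X` differing by
`≥ (c − ε) · rankinRate X`) is the `G(X) ≥ (c + o(1)) · rate(X)` phrasing under which
Ford–Green–Konyagin–Tao (p. 936) attribute the result to Rankin (1938). The construction proves the
`G(X)` form directly (for EVERY large `X` it exhibits a gap below `X`), and the `G(X)` form implies
the `limsup` display; we prove the `G(X)` form, which is what the named fact states.

Inputs, all proved in the tree: the deterministic three-sieving criterion
`ErdosRankin.residueClassesCover_of_count` and the Mertens ratio bound
`ErdosRankin.prod_one_sub_inv_Ioc_le` (`LargeGapsErdosProofs.lean`); Rankin's bound with explicit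
Euler product `card_smoothNumbersUpTo_le_rankin_exp` (`RankinSmoothBound.lean`); the prime number
theorem `LFunctions.primeCounting_isEquivalent_holds`; `hasPrimeGap_of_cover`, `primorial_le_four_pow`.

References: Montgomery–Vaughan, *Multiplicative Number Theory I*, §7.3, Lemma 7.13 and Theorem 7.15,
pp. 221–223 [MontgomeryVaughan2007]; R. A. Rankin, *The difference between consecutive prime
numbers*, J. London Math. Soc. 13 (1938) 242–247 [Rankin1938]; K. Ford, B. Green, S. Konyagin,
T. Tao, *Large gaps between consecutive prime numbers*, Ann. of Math. 183 (2016), p. 936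
[FordGreenKonyaginTao2016].
-/

noncomputable section

open Filter Finset

namespace Literature.NumberTheory.Sieve

namespace Rankin38

/-! ### The smooth-number bound with `η = 7 log₂ z / log z` -/

/-- **`Ψ(N, M+1) ≤ e^{−3} N/(log z)²`** from the tree's Rankin bound with `η = 7 log₂ z/log z`,
provided `z ≤ N`, `M + 1 ≤ z`, `η ≤ 1/2` and the Euler-product cost satisfies
`4 η (M+1)^η (log(M+1) + 2) ≤ log₂ z − 19` (Rankin's `x^{1−η}`-trick with `η` of order
`log₂/log`, MV (7.49)). [cite: MontgomeryVaughan2007, Theorem 7.15 (proof, (7.49))]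
[cite: Rankin1938, Lemma II] -/
theorem card_smooth_le_seven {N M z : ℕ} {η : ℝ} (hz : 3 ≤ z) (hzN : z ≤ N) (hM1 : 1 ≤ M)
    (hMz : M + 1 ≤ z) (hη0 : 0 < η) (hη : η ≤ 1 / 2)
    (hηdef : η * Real.log z = 7 * Real.log (Real.log z))
    (hT : 4 * (η * ((M : ℝ) + 1) ^ η * (Real.log ((M : ℝ) + 1) + 2)) ≤
      Real.log (Real.log z) - 19) :
    ((N.smoothNumbersUpTo (M + 1)).card : ℝ) ≤ N * Real.exp (-3) / (Real.log z) ^ 2 := by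
  have hk : 2 ≤ M + 1 := by omega
  have h := card_smoothNumbersUpTo_le_rankin_exp N hk hη0 hη
  have hzr : (3 : ℝ) ≤ z := by exact_mod_cast hz
  have hNr : (3 : ℝ) ≤ N := by exact_mod_cast (hz.trans hzN)
  have hzN' : (z : ℝ) ≤ N := by exact_mod_cast hzN
  have hN0 : (0 : ℝ) < N := by linarith
  have hz0 : (0 : ℝ) < z := by linarith
  have hlogz : 1 < Real.log z := by
    rw [← Real.exp_lt_exp, Real.exp_log hz0]
    have := Real.exp_one_lt_d9; linarith
  have hlogz0 : 0 < Real.log z := by linarith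
  have hMr : (2 : ℝ) ≤ (M : ℝ) + 1 := by exact_mod_cast (show 2 ≤ M + 1 by omega)
  have hMz' : (M : ℝ) + 1 ≤ z := by exact_mod_cast hMz
  have hlogM0 : 0 < Real.log ((M : ℝ) + 1) := Real.log_pos (by linarith)
  -- `N^{1-η} ≤ N / (log z)^7`
  have h1 : (N : ℝ) ^ (1 - η) ≤ N / (Real.log z) ^ 7 := by
    rw [Real.rpow_sub hN0, Real.rpow_one]
    have hzη : (Real.log z) ^ 7 ≤ (N : ℝ) ^ η := by
      calc (Real.log z) ^ 7 = Real.exp (7 * Real.log (Real.log z)) := by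
            rw [show (7 : ℝ) * Real.log (Real.log z) = ((7 : ℕ) : ℝ) * Real.log (Real.log z) by
              norm_num, ← Real.log_pow, Real.exp_log (by positivity)]
        _ = Real.exp (η * Real.log z) := by rw [hηdef]
        _ = (z : ℝ) ^ η := by rw [Real.rpow_def_of_pos hz0, mul_comm]
        _ ≤ (N : ℝ) ^ η := Real.rpow_le_rpow hz0.le hzN' hη0.le
    exact div_le_div_of_nonneg_left hN0.le (by positivity) hzη
  have h2 : Real.log (Real.log ((M : ℝ) + 1)) ≤ Real.log (Real.log z) :=
    Real.log_le_log hlogM0 (Real.log_le_log (by linarith) hMz')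
  have h5 : Real.exp (4 * (Real.log (Real.log ((M + 1 : ℕ) : ℝ)) + 4) +
      4 * (η * ((M + 1 : ℕ) : ℝ) ^ η * (Real.log ((M + 1 : ℕ) : ℝ) + 2))) ≤
      (Real.log z) ^ 5 * Real.exp (-3) := by
    push_cast
    calc Real.exp (4 * (Real.log (Real.log ((M : ℝ) + 1)) + 4) +
          4 * (η * ((M : ℝ) + 1) ^ η * (Real.log ((M : ℝ) + 1) + 2)))
        ≤ Real.exp (5 * Real.log (Real.log z) + (-3)) := by
          rw [Real.exp_le_exp]; linarith
      _ = (Real.log z) ^ 5 * Real.exp (-3) := by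
          rw [Real.exp_add, show (5 : ℝ) * Real.log (Real.log z) =
            ((5 : ℕ) : ℝ) * Real.log (Real.log z) by norm_num, ← Real.log_pow,
            Real.exp_log (by positivity)]
  calc ((N.smoothNumbersUpTo (M + 1)).card : ℝ)
      ≤ (N : ℝ) ^ (1 - η) * Real.exp (4 * (Real.log (Real.log ((M + 1 : ℕ) : ℝ)) + 4) +
          4 * (η * ((M + 1 : ℕ) : ℝ) ^ η * (Real.log ((M + 1 : ℕ) : ℝ) + 2))) := h
    _ ≤ (N / (Real.log z) ^ 7) * ((Real.log z) ^ 5 * Real.exp (-3)) := by gcongr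
    _ = N * Real.exp (-3) / (Real.log z) ^ 2 := by field_simp

/-! ### The parameters `L = ⌊log z · log₃ z/(672 (log₂ z)²)⌋`, `K = 2L+1`, `M = K^{24L}`,
`η = 7 log₂ z/log z` -/

open Asymptotics in
/-- The growth facts used: eventually `log₂ z ≥ e^{12}` and
`672 (e^{48} + 2)(log₂ z)² ≤ log z`. [folklore] -/
private theorem eventually_growth :
    ∀ᶠ z : ℕ in atTop, Real.exp 12 ≤ Real.log (Real.log z) ∧
      (Real.exp 48 + 2) * 672 * (Real.log (Real.log z)) ^ 2 ≤ Real.log z := by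
  have hT : Tendsto (fun z : ℕ => Real.log z) atTop atTop :=
    Real.tendsto_log_atTop.comp tendsto_natCast_atTop_atTop
  have hT₂ : Tendsto (fun z : ℕ => Real.log (Real.log z)) atTop atTop :=
    Real.tendsto_log_atTop.comp hT
  have hε : (0 : ℝ) < 1 / ((Real.exp 48 + 2) * 672) := by positivity
  have ho := (Real.isLittleO_pow_log_id_atTop (n := 2)).bound hε
  filter_upwards [hT₂.eventually_ge_atTop (Real.exp 12), hT.eventually ho,
    hT.eventually_ge_atTop 1] with z h12 hb h1
  refine ⟨h12, ?_⟩
  rw [Real.norm_eq_abs, Real.norm_eq_abs, id, abs_of_nonneg (by positivity),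
    abs_of_nonneg (by linarith)] at hb
  have hpos : (0 : ℝ) < (Real.exp 48 + 2) * 672 := by positivity
  calc (Real.exp 48 + 2) * 672 * Real.log (Real.log z) ^ 2
      ≤ (Real.exp 48 + 2) * 672 * (1 / ((Real.exp 48 + 2) * 672) * Real.log z) := by gcongr
    _ = Real.log z := by field_simp

/-- Deterministic consequences for `L = ⌊ℓ ℓ₃/(672 ℓ₂²)⌋`, `K = 2L + 1` (`ℓ₂ = log ℓ ≥ e^{12}`,
`ℓ₃ = log ℓ₂`, `672 (e^{48}+2) ℓ₂² ≤ ℓ`): `L ≥ 1`, `log K ≥ 48`, `24 L log K ≤ ℓ/28`,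
`L ≤ ℓ ℓ₃/(672 ℓ₂²) ≤ ℓ`, `14 ℓ₂ ≤ ℓ`, `(7ℓ₂/ℓ) · 24 L log K ≤ ℓ₃/4`, and the Euler-product cost
bound `4 (ℓ₃/4 + 3/2) e^{ℓ₃/4 + 1/2} ≤ ℓ₂ − 19`. [folklore] -/
private theorem params {ℓ ℓ₂ ℓ₃ : ℝ} {L : ℕ} (h12 : Real.exp 12 ≤ ℓ₂)
    (hB : (Real.exp 48 + 2) * 672 * ℓ₂ ^ 2 ≤ ℓ) (hℓ₂def : ℓ₂ = Real.log ℓ)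
    (hℓ₃def : ℓ₃ = Real.log ℓ₂) (hL : L = ⌊ℓ * ℓ₃ / (672 * ℓ₂ ^ 2)⌋₊) :
    1 ≤ L ∧ (48 : ℝ) ≤ Real.log ((2 * L + 1 : ℕ) : ℝ) ∧
      (24 * L : ℝ) * Real.log ((2 * L + 1 : ℕ) : ℝ) ≤ ℓ / 28 ∧
      (L : ℝ) ≤ ℓ * ℓ₃ / (672 * ℓ₂ ^ 2) ∧ (L : ℝ) ≤ ℓ ∧ 14 * ℓ₂ ≤ ℓ ∧
      (7 * ℓ₂ / ℓ) * ((24 * L : ℝ) * Real.log ((2 * L + 1 : ℕ) : ℝ)) ≤ ℓ₃ / 4 ∧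
      4 * (ℓ₃ / 4 + 3 / 2) * Real.exp (ℓ₃ / 4 + 1 / 2) ≤ ℓ₂ - 19 ∧ 12 ≤ ℓ₃ := by
  have he12 : (12 : ℝ) + 1 ≤ Real.exp 12 := Real.add_one_le_exp 12
  have hℓ₂0 : 0 < ℓ₂ := by linarith
  have hℓ₂1 : 1 ≤ ℓ₂ := by linarith
  have hℓ₃12 : 12 ≤ ℓ₃ := by
    rw [hℓ₃def]
    calc (12 : ℝ) = Real.log (Real.exp 12) := (Real.log_exp 12).symm
      _ ≤ Real.log ℓ₂ := Real.log_le_log (Real.exp_pos 12) h12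
  have hℓ₃le : ℓ₃ ≤ ℓ₂ - 1 := by rw [hℓ₃def]; exact Real.log_le_sub_one_of_pos hℓ₂0
  have hℓ₃0 : 0 < ℓ₃ := by linarith
  have hℓ₃1 : 1 ≤ ℓ₃ := by linarith
  have he48 : (48 : ℝ) + 1 ≤ Real.exp 48 := Real.add_one_le_exp 48
  have hℓ₂sq : ℓ₂ ≤ ℓ₂ ^ 2 := by nlinarith only [hℓ₂1]
  have hℓbig : 49 * 672 * ℓ₂ ^ 2 ≤ ℓ := by nlinarith only [hB, he48, sq_nonneg ℓ₂]
  have hℓ14 : 14 * ℓ₂ ≤ ℓ := by nlinarith only [hℓbig, hℓ₂sq, hℓ₂0]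
  have hℓ0 : 0 < ℓ := by linarith only [hℓ14, hℓ₂0]
  have hD0 : (0 : ℝ) < 672 * ℓ₂ ^ 2 := by positivity
  have hquot : Real.exp 48 + 2 ≤ ℓ * ℓ₃ / (672 * ℓ₂ ^ 2) := by
    rw [le_div_iff₀ hD0]
    have h1 : ℓ ≤ ℓ * ℓ₃ := le_mul_of_one_le_right hℓ0.le hℓ₃1
    have h2 : (Real.exp 48 + 2) * (672 * ℓ₂ ^ 2) = (Real.exp 48 + 2) * 672 * ℓ₂ ^ 2 := by ring
    linarith only [hB, h1, h2]
  have hLr : ℓ * ℓ₃ / (672 * ℓ₂ ^ 2) - 1 < L := by rw [hL]; exact Nat.sub_one_lt_floor _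
  have hLle : (L : ℝ) ≤ ℓ * ℓ₃ / (672 * ℓ₂ ^ 2) := by rw [hL]; exact Nat.floor_le (by positivity)
  have hL48 : Real.exp 48 + 1 < L := by linarith
  have hL1r : (1 : ℝ) ≤ L := by linarith [Real.exp_pos 48]
  have hL1 : 1 ≤ L := by exact_mod_cast hL1r
  have hKr : ((2 * L + 1 : ℕ) : ℝ) = 2 * L + 1 := by push_cast; ring
  have hK48 : (48 : ℝ) ≤ Real.log ((2 * L + 1 : ℕ) : ℝ) := by
    rw [hKr]
    have : Real.exp 48 ≤ 2 * (L : ℝ) + 1 := by linarith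
    calc (48 : ℝ) = Real.log (Real.exp 48) := (Real.log_exp 48).symm
      _ ≤ Real.log (2 * L + 1) := Real.log_le_log (Real.exp_pos 48) this
  -- `L ≤ ℓ ℓ₃/(672 ℓ₂²) ≤ ℓ/3`, so `log K ≤ log ℓ = ℓ₂`
  have hquot3 : ℓ * ℓ₃ / (672 * ℓ₂ ^ 2) ≤ ℓ / 3 := by
    rw [div_le_div_iff₀ hD0 (by norm_num)]
    have h1 : 3 * ℓ₃ ≤ 672 * ℓ₂ ^ 2 := by nlinarith only [hℓ₃le, hℓ₂sq, sq_nonneg ℓ₂]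
    have h2 := mul_le_mul_of_nonneg_left h1 hℓ0.le
    linarith only [h2]
  have hLℓ3 : (L : ℝ) ≤ ℓ / 3 := hLle.trans hquot3
  have hlogK : Real.log ((2 * L + 1 : ℕ) : ℝ) ≤ ℓ₂ := by
    rw [hKr, hℓ₂def]
    exact Real.log_le_log (by linarith) (by linarith)
  have hlogK0 : 0 ≤ Real.log ((2 * L + 1 : ℕ) : ℝ) := by linarith
  have hlogM : (24 * L : ℝ) * Real.log ((2 * L + 1 : ℕ) : ℝ) ≤ ℓ * ℓ₃ / (28 * ℓ₂) := by
    calc (24 * L : ℝ) * Real.log ((2 * L + 1 : ℕ) : ℝ)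
        ≤ 24 * (ℓ * ℓ₃ / (672 * ℓ₂ ^ 2)) * ℓ₂ := by gcongr
      _ = ℓ * ℓ₃ / (28 * ℓ₂) := by field_simp; ring
  have hℓℓ₂ : ℓ * ℓ₃ / (28 * ℓ₂) ≤ ℓ / 28 := by
    rw [div_le_div_iff₀ (by positivity) (by norm_num)]
    have h1 := mul_le_mul_of_nonneg_left (show ℓ₃ ≤ ℓ₂ by linarith only [hℓ₃le]) hℓ0.le
    linarith only [h1]
  -- the Euler-product cost: `v = e^{ℓ₃/4} ≥ 4`, `ℓ₂ = v⁴`, `ℓ₃/4 ≤ v − 1`, `e^{1/2} ≤ 2`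
  have hcost : 4 * (ℓ₃ / 4 + 3 / 2) * Real.exp (ℓ₃ / 4 + 1 / 2) ≤ ℓ₂ - 19 := by
    obtain ⟨v, hv⟩ : ∃ v : ℝ, v = Real.exp (ℓ₃ / 4) := ⟨_, rfl⟩
    have hv4 : 4 ≤ v := by
      have h3 : (3 : ℝ) + 1 ≤ Real.exp 3 := Real.add_one_le_exp 3
      have : Real.exp 3 ≤ Real.exp (ℓ₃ / 4) := Real.exp_le_exp.2 (by linarith)
      linarith
    have hℓ₂v : ℓ₂ = v ^ 4 := by
      rw [hv, ← Real.exp_nat_mul, show ((4 : ℕ) : ℝ) * (ℓ₃ / 4) = ℓ₃ by push_cast; ring, hℓ₃def,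
        Real.exp_log hℓ₂0]
    have hlogv : ℓ₃ / 4 ≤ v - 1 := by
      have := Real.add_one_le_exp (ℓ₃ / 4); linarith
    have hehalf : Real.exp (1 / 2) ≤ 2 := by
      have h2 : Real.exp (Real.log 2) = 2 := Real.exp_log (by norm_num)
      have := Real.log_two_gt_d9
      calc Real.exp (1 / 2) ≤ Real.exp (Real.log 2) := Real.exp_le_exp.2 (by linarith)
        _ = 2 := h2
    have hexp : Real.exp (ℓ₃ / 4 + 1 / 2) ≤ 2 * v := by
      rw [Real.exp_add, hv, mul_comm]
      exact mul_le_mul_of_nonneg_right hehalf (Real.exp_pos _).le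
    have hv0 : 0 ≤ v := by linarith
    have hf : ℓ₃ / 4 + 3 / 2 ≤ v + 1 / 2 := by linarith
    have hprod := mul_le_mul hf hexp (Real.exp_pos _).le (by linarith)
    have hv2 : 16 ≤ v ^ 2 := by nlinarith only [hv4]
    have hv4' : 16 * v ^ 2 ≤ v ^ 4 := by
      have : v ^ 4 = v ^ 2 * v ^ 2 := by ring
      rw [this]; exact mul_le_mul_of_nonneg_right hv2 (sq_nonneg v)
    have h4v : 4 * v ≤ v ^ 2 := by nlinarith only [hv4, hv0]
    calc 4 * (ℓ₃ / 4 + 3 / 2) * Real.exp (ℓ₃ / 4 + 1 / 2)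
        = 4 * ((ℓ₃ / 4 + 3 / 2) * Real.exp (ℓ₃ / 4 + 1 / 2)) := by ring
      _ ≤ 4 * ((v + 1 / 2) * (2 * v)) := by linarith only [hprod]
      _ = 8 * v ^ 2 + 4 * v := by ring
      _ ≤ v ^ 4 - 19 := by linarith only [hv2, hv4', h4v]
      _ = ℓ₂ - 19 := by rw [hℓ₂v]
  refine ⟨hL1, hK48, hlogM.trans hℓℓ₂, hLle, by linarith, hℓ14, ?_, hcost, hℓ₃12⟩
  calc 7 * ℓ₂ / ℓ * ((24 * L : ℝ) * Real.log ((2 * L + 1 : ℕ) : ℝ))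
      ≤ 7 * ℓ₂ / ℓ * (ℓ * ℓ₃ / (28 * ℓ₂)) := by gcongr
    _ = ℓ₃ / 4 := by field_simp; ring

/-! ### The prime number theorem along the parameters -/

open Asymptotics in
/-- The prime number theorem (tree: `primeCounting_isEquivalent_holds`) as two-sided bounds.
[folklore] -/
private theorem eventually_abs_primeCounting_sub_le {κ : ℝ} (hκ : 0 < κ) :
    ∀ᶠ x : ℝ in atTop,
      |(Nat.primeCounting ⌊x⌋₊ : ℝ) - x / Real.log x| ≤ κ * (x / Real.log x) := by
  have h0 : (fun x : ℝ ↦ (Nat.primeCounting ⌊x⌋₊ : ℝ)) ~[atTop] fun x ↦ x / Real.log x :=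
    Literature.NumberTheory.LFunctions.primeCounting_isEquivalent_holds
  filter_upwards [h0.isLittleO.bound hκ, eventually_ge_atTop (1 : ℝ)] with x hx hx1
  have hx0 : 0 ≤ x := by linarith
  have hl0 : 0 ≤ Real.log x := Real.log_nonneg hx1
  have hnn : 0 ≤ x / Real.log x := div_nonneg hx0 hl0
  simpa [Real.norm_eq_abs, abs_div, abs_of_nonneg hnn, abs_of_nonneg hx0, abs_of_nonneg hl0]
    using hx

/-- Eventually `L(z) ≥ 1`. [folklore] -/
private theorem eventually_one_le_L :
    ∀ᶠ z : ℕ in atTop, 1 ≤ ⌊Real.log z * Real.log (Real.log (Real.log z)) /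
      (672 * (Real.log (Real.log z)) ^ 2)⌋₊ := by
  filter_upwards [eventually_growth] with z hg
  exact (params hg.1 hg.2 rfl rfl rfl).1

/-- PNT consequences along the parameters: `π(Lz) ≤ 1.1 L z/log z`, `π(z) ≥ 0.9 z/log z`,
`π(⌊z/2⌋) ≤ 0.605 z/log z`. [folklore] -/
private theorem eventually_pnt_bounds :
    ∀ᶠ z : ℕ in atTop,
      (Nat.primeCounting (⌊Real.log z * Real.log (Real.log (Real.log z)) /
          (672 * (Real.log (Real.log z)) ^ 2)⌋₊ * z) : ℝ) ≤
          11 / 10 * (((⌊Real.log z * Real.log (Real.log (Real.log z)) /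
            (672 * (Real.log (Real.log z)) ^ 2)⌋₊ : ℕ) : ℝ) * (z / Real.log z)) ∧
      9 / 10 * (z / Real.log z) ≤ (Nat.primeCounting z : ℝ) ∧
      (Nat.primeCounting (z / 2) : ℝ) ≤ 121 / 200 * (z / Real.log z) := by
  have hκ : (0 : ℝ) < 1 / 10 := by norm_num
  have hcast : Tendsto (fun z : ℕ => (z : ℝ)) atTop atTop := tendsto_natCast_atTop_atTop
  set f : ℕ → ℕ := fun z => ⌊Real.log z * Real.log (Real.log (Real.log z)) /
    (672 * (Real.log (Real.log z)) ^ 2)⌋₊ * z with hf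
  have hfge : ∀ᶠ z : ℕ in atTop, z ≤ f z := by
    filter_upwards [eventually_one_le_L] with z hz
    exact Nat.le_mul_of_pos_left z hz
  have hft : Tendsto f atTop atTop := tendsto_atTop_mono' atTop hfge tendsto_id
  have h1 := (hcast.comp hft).eventually (eventually_abs_primeCounting_sub_le hκ)
  have h2 := hcast.eventually (eventually_abs_primeCounting_sub_le hκ)
  have h3 := (hcast.atTop_div_const (by norm_num : (0 : ℝ) < 2)).eventually
    (eventually_abs_primeCounting_sub_le hκ)
  filter_upwards [h1, h2, h3, eventually_ge_atTop 2048, hfge] with z hz1 hz2 hz3 hz hzf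
  have hz' : (2048 : ℝ) ≤ z := by exact_mod_cast hz
  have hzpos : (0 : ℝ) < z := by linarith
  have hlog2 : Real.log 2048 = 11 * Real.log 2 := by
    rw [show (2048 : ℝ) = 2 ^ 11 by norm_num, Real.log_pow]; norm_num
  have hlogz : 11 * Real.log 2 ≤ Real.log z := hlog2 ▸ Real.log_le_log (by norm_num) hz'
  have hlog2pos : 0 < Real.log 2 := Real.log_pos (by norm_num)
  have hlogzpos : 0 < Real.log z := by linarith
  have hW0 : 0 ≤ (z : ℝ) / Real.log z := by positivity
  refine ⟨?_, ?_, ?_⟩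
  · have hfl : ⌊((f z : ℕ) : ℝ)⌋₊ = f z := Nat.floor_natCast _
    simp only [Function.comp_apply] at hz1
    rw [hfl] at hz1
    have hfz : ((f z : ℕ) : ℝ) = ((⌊Real.log z * Real.log (Real.log (Real.log z)) /
        (672 * (Real.log (Real.log z)) ^ 2)⌋₊ : ℕ) : ℝ) * z := by
      rw [hf]; push_cast; ring
    have hfz' : (z : ℝ) ≤ ((f z : ℕ) : ℝ) := by exact_mod_cast hzf
    have hlogf : Real.log z ≤ Real.log ((f z : ℕ) : ℝ) := Real.log_le_log hzpos hfz'
    have hL0 : (0 : ℝ) ≤ ((⌊Real.log z * Real.log (Real.log (Real.log z)) /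
        (672 * (Real.log (Real.log z)) ^ 2)⌋₊ : ℕ) : ℝ) := by positivity
    have hq : ((f z : ℕ) : ℝ) / Real.log ((f z : ℕ) : ℝ) ≤
        ((⌊Real.log z * Real.log (Real.log (Real.log z)) /
          (672 * (Real.log (Real.log z)) ^ 2)⌋₊ : ℕ) : ℝ) * (z / Real.log z) :=
      calc ((f z : ℕ) : ℝ) / Real.log ((f z : ℕ) : ℝ) ≤ ((f z : ℕ) : ℝ) / Real.log z :=
            div_le_div_of_nonneg_left (by positivity) hlogzpos hlogf
        _ = ((⌊Real.log z * Real.log (Real.log (Real.log z)) /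
              (672 * (Real.log (Real.log z)) ^ 2)⌋₊ : ℕ) : ℝ) * (z / Real.log z) := by
            rw [hfz]; ring
    have := (abs_le.1 hz1).2
    have hf0 : 0 ≤ ((f z : ℕ) : ℝ) / Real.log ((f z : ℕ) : ℝ) :=
      div_nonneg (by positivity) (hlogzpos.le.trans hlogf)
    change (Nat.primeCounting (f z) : ℝ) ≤ _
    nlinarith [hq, hL0]
  · have hfl : ⌊(z : ℝ)⌋₊ = z := Nat.floor_natCast z
    rw [hfl] at hz2
    have := (abs_le.1 hz2).1
    linarith
  · have hfl : ⌊(z : ℝ) / 2⌋₊ = z / 2 := Nat.floor_div_eq_div z 2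
    rw [hfl] at hz3
    have := (abs_le.1 hz3).2
    have hlogh : Real.log ((z : ℝ) / 2) = Real.log z - Real.log 2 := by
      rw [Real.log_div hzpos.ne' (by norm_num)]
    have hlogh' : 10 / 11 * Real.log z ≤ Real.log ((z : ℝ) / 2) := by rw [hlogh]; linarith
    have hloghpos : 0 < Real.log ((z : ℝ) / 2) := by linarith
    have hq : (z : ℝ) / 2 / Real.log ((z : ℝ) / 2) ≤ 11 / 20 * (z / Real.log z) := by
      rw [div_le_iff₀ hloghpos]
      calc (z : ℝ) / 2 = 11 / 20 * (z / Real.log z) * (10 / 11 * Real.log z) := by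
            field_simp; ring
        _ ≤ 11 / 20 * (z / Real.log z) * Real.log ((z : ℝ) / 2) := by gcongr
    linarith

/-! ### Rankin's cover `Y(z) ≥ L(z) · z` -/

/-- The cover for one `z`, all parameters explicit (`ℓ = log z`, `ℓ₂ = log ℓ`, `ℓ₃ = log ℓ₂`,
`L = ⌊ℓ ℓ₃/(672 ℓ₂²)⌋`, `K = 2L+1`, `M = K^{24L}`, `N = Lz`), given the growth facts and the three
PNT bounds. [folklore] -/
private theorem cover_of_params {z L K M N : ℕ} {ℓ ℓ₂ ℓ₃ : ℝ} (hz3 : 3 ≤ z) (hℓ : ℓ = Real.log z)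
    (hℓ₂ : ℓ₂ = Real.log ℓ) (hℓ₃ : ℓ₃ = Real.log ℓ₂) (hL : L = ⌊ℓ * ℓ₃ / (672 * ℓ₂ ^ 2)⌋₊)
    (hK : K = 2 * L + 1) (hM : M = K ^ (24 * L)) (hN : N = L * z) (h12 : Real.exp 12 ≤ ℓ₂)
    (hB : (Real.exp 48 + 2) * 672 * ℓ₂ ^ 2 ≤ ℓ)
    (hπN : (Nat.primeCounting N : ℝ) ≤ 11 / 10 * (L * (z / ℓ)))
    (hπz : 9 / 10 * (z / ℓ) ≤ (Nat.primeCounting z : ℝ))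
    (hπQ : (Nat.primeCounting (z / 2) : ℝ) ≤ 121 / 200 * (z / ℓ)) :
    ResidueClassesCover z N := by
  obtain ⟨hL1, hK48, hlogM, hLle, hLℓ, h14, hηlogM, hcost, hℓ₃12⟩ := params h12 hB hℓ₂ hℓ₃ hL
  rw [← hK] at hK48 hlogM hηlogM
  -- positivity
  have hzr : (3 : ℝ) ≤ z := by exact_mod_cast hz3
  have hz0 : (0 : ℝ) < z := by linarith
  have hℓ1 : 1 < ℓ := by
    rw [hℓ, ← Real.exp_lt_exp, Real.exp_log hz0]
    have := Real.exp_one_lt_d9; linarith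
  have hℓ0 : 0 < ℓ := by linarith
  have he12 : (12 : ℝ) + 1 ≤ Real.exp 12 := Real.add_one_le_exp 12
  have hℓ₂0 : 0 < ℓ₂ := by linarith
  have hexpℓ : Real.exp ℓ = z := by rw [hℓ, Real.exp_log hz0]
  have hexpℓ₂ : Real.exp ℓ₂ = ℓ := by rw [hℓ₂, Real.exp_log hℓ0]
  have hLr0 : (0 : ℝ) < L := by exact_mod_cast hL1
  -- `K`, `M`
  have hK2 : 2 ≤ K := by omega
  have hlogK0 : 0 < Real.log (K : ℝ) := by linarith
  have hMr : (M : ℝ) = (K : ℝ) ^ (24 * L) := by rw [hM]; push_cast; ring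
  have hlogMeq : Real.log M = (24 * L : ℝ) * Real.log K := by
    rw [hMr, Real.log_pow]; push_cast; ring
  have hKM : K ≤ M := by rw [hM]; exact Nat.le_self_pow (by omega) K
  have hM1 : 1 ≤ M := le_trans (by omega) hKM
  have hM0r : (0 : ℝ) < M := by exact_mod_cast (show 0 < M by omega)
  have hlogMle : Real.log M ≤ ℓ / 28 := by rw [hlogMeq]; exact hlogM
  have hMle : (M : ℝ) ≤ z / (20 * ℓ) := by
    have h20 := Real.log_le_sub_one_of_pos (show (0 : ℝ) < 20 by norm_num)
    have h20' : Real.exp (Real.log 20) = 20 := Real.exp_log (by norm_num)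
    have h1 : Real.log M ≤ ℓ - (Real.log 20 + ℓ₂) := by linarith
    calc (M : ℝ) = Real.exp (Real.log M) := (Real.exp_log hM0r).symm
      _ ≤ Real.exp (ℓ - (Real.log 20 + ℓ₂)) := Real.exp_le_exp.2 h1
      _ = z / (20 * ℓ) := by rw [Real.exp_sub, Real.exp_add, h20', hexpℓ, hexpℓ₂]
  have hMz20 : (M : ℝ) ≤ z / 20 := by
    refine hMle.trans (div_le_div_of_nonneg_left hz0.le (by norm_num) ?_)
    linarith
  have hMQ : M ≤ z / 2 := by
    rw [Nat.le_div_iff_mul_le (by norm_num)]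
    have : (M : ℝ) * 2 ≤ z := by linarith
    exact_mod_cast this
  have hMz : M + 1 ≤ z := by
    have : (M : ℝ) + 1 ≤ z := by linarith
    exact_mod_cast this
  -- `η = 7 ℓ₂/ℓ` and the Euler-product cost
  obtain ⟨η, hη⟩ : ∃ η : ℝ, η = 7 * ℓ₂ / ℓ := ⟨_, rfl⟩
  have hη0 : 0 < η := by rw [hη]; positivity
  have hηhalf : η ≤ 1 / 2 := by rw [hη, div_le_iff₀ hℓ0]; linarith
  have hηdef : η * Real.log z = 7 * Real.log (Real.log z) := by
    rw [hη, ← hℓ, ← hℓ₂]; field_simp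
  have hηlogM' : η * Real.log M ≤ ℓ₃ / 4 := by rw [hlogMeq, hη]; exact hηlogM
  have hM1r : (1 : ℝ) ≤ M := by exact_mod_cast hM1
  have hlog2 : Real.log 2 ≤ 1 := by
    have := Real.log_two_lt_d9; norm_num at this; linarith
  have hlogM1 : Real.log ((M : ℝ) + 1) ≤ Real.log M + 1 := by
    calc Real.log ((M : ℝ) + 1) ≤ Real.log (2 * M) :=
          Real.log_le_log (by linarith) (by linarith)
      _ = Real.log 2 + Real.log M := Real.log_mul (by norm_num) hM0r.ne'
      _ ≤ Real.log M + 1 := by linarith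
  have hlogM10 : 0 < Real.log ((M : ℝ) + 1) := Real.log_pos (by linarith)
  have hηlog1 : η * Real.log ((M : ℝ) + 1) ≤ ℓ₃ / 4 + 1 / 2 := by
    have h2 := mul_le_mul_of_nonneg_left hlogM1 hη0.le
    have h3 : η * (Real.log (M : ℝ) + 1) = η * Real.log (M : ℝ) + η := by ring
    linarith
  have hpowη : ((M : ℝ) + 1) ^ η ≤ Real.exp (ℓ₃ / 4 + 1 / 2) := by
    rw [Real.rpow_def_of_pos (by linarith), Real.exp_le_exp, mul_comm]; exact hηlog1
  have hT : 4 * (η * ((M : ℝ) + 1) ^ η * (Real.log ((M : ℝ) + 1) + 2)) ≤ ℓ₂ - 19 := by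
    have hpow0 : 0 ≤ ((M : ℝ) + 1) ^ η := Real.rpow_nonneg (by linarith) η
    have hf : η * (Real.log ((M : ℝ) + 1) + 2) ≤ ℓ₃ / 4 + 3 / 2 := by
      have : η * (Real.log ((M : ℝ) + 1) + 2) = η * Real.log ((M : ℝ) + 1) + 2 * η := by ring
      linarith
    have hf0 : 0 ≤ η * (Real.log ((M : ℝ) + 1) + 2) := by positivity
    calc 4 * (η * ((M : ℝ) + 1) ^ η * (Real.log ((M : ℝ) + 1) + 2))
        = 4 * ((η * (Real.log ((M : ℝ) + 1) + 2)) * ((M : ℝ) + 1) ^ η) := by ring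
      _ ≤ 4 * ((ℓ₃ / 4 + 3 / 2) * Real.exp (ℓ₃ / 4 + 1 / 2)) := by gcongr
      _ = 4 * (ℓ₃ / 4 + 3 / 2) * Real.exp (ℓ₃ / 4 + 1 / 2) := by ring
      _ ≤ ℓ₂ - 19 := hcost
  rw [hℓ₂, hℓ] at hT
  -- the smooth-number bound and the shape conditions
  have hzN : z ≤ N := by rw [hN]; exact Nat.le_mul_of_pos_left z hL1
  have hΨ := card_smooth_le_seven hz3 hzN hM1 hMz hη0 hηhalf hηdef hT
  rw [← hℓ] at hΨ
  have hNQK : N < (z / 2 + 1) * (K + 1) := by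
    have h2Q : z < 2 * (z / 2 + 1) := by omega
    calc N = L * z := hN
      _ < L * (2 * (z / 2 + 1)) := Nat.mul_lt_mul_of_pos_left h2Q hL1
      _ ≤ L * (2 * (z / 2 + 1)) + 2 * (z / 2 + 1) := Nat.le_add_right _ _
      _ = (z / 2 + 1) * (K + 1) := by rw [hK]; ring
  -- Mertens: the greedy product is `≤ 1/(8L)`
  have hprod : ∏ p ∈ (Ioc K M).filter Nat.Prime, (1 - 1 / (p : ℝ)) ≤ 1 / (8 * L) := by
    have := ErdosRankin.prod_one_sub_inv_Ioc_le hK2 hK48 hKM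
    rw [hlogMeq] at this
    refine this.trans (le_of_eq ?_)
    field_simp
    ring
  -- the count
  have hNr : (N : ℝ) = L * z := by rw [hN]; push_cast; ring
  obtain ⟨W, hW⟩ : ∃ W : ℝ, W = (z : ℝ) / ℓ := ⟨_, rfl⟩
  rw [← hW] at hπN hπz hπQ
  have hW0 : 0 ≤ W := by rw [hW]; positivity
  have he3 : Real.exp (-3) ≤ 1 / 4 := by
    have h3 : (3 : ℝ) + 1 ≤ Real.exp 3 := Real.add_one_le_exp 3
    rw [Real.exp_neg, inv_eq_one_div, div_le_div_iff₀ (Real.exp_pos 3) (by norm_num)]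
    linarith
  have hA : (N : ℝ) * Real.exp (-3) / ℓ ^ 2 * (1 / (8 * L)) ≤ 1 / 32 * W := by
    have hℓinv : 1 / ℓ ≤ 1 := by rw [div_le_one hℓ0]; exact hℓ1.le
    calc (N : ℝ) * Real.exp (-3) / ℓ ^ 2 * (1 / (8 * L)) = W * (1 / ℓ) * Real.exp (-3) / 8 := by
          rw [hNr, hW]; field_simp
      _ ≤ W * 1 * (1 / 4) / 8 := by gcongr
      _ = 1 / 32 * W := by ring
  have hB' : (Nat.primeCounting N : ℝ) * (1 / (8 * L)) ≤ 11 / 80 * W := by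
    have h8 : (0 : ℝ) ≤ 1 / (8 * L) := by positivity
    calc (Nat.primeCounting N : ℝ) * (1 / (8 * L)) ≤ 11 / 10 * (L * W) * (1 / (8 * L)) :=
          mul_le_mul_of_nonneg_right hπN h8
      _ = 11 / 80 * W := by field_simp; ring
  have hM' : (M : ℝ) ≤ 1 / 20 * W := by
    rw [hW, show 1 / 20 * ((z : ℝ) / ℓ) = z / (20 * ℓ) by ring]; exact hMle
  have hcount : (((N.smoothNumbersUpTo (M + 1)).card : ℝ) + Nat.primeCounting N) *
      (∏ p ∈ (Ioc K M).filter Nat.Prime, (1 - 1 / (p : ℝ))) + M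
      ≤ (Nat.primeCounting z : ℝ) - Nat.primeCounting (z / 2) := by
    have hS0 : 0 ≤ ((N.smoothNumbersUpTo (M + 1)).card : ℝ) + Nat.primeCounting N := by
      positivity
    have h1 := mul_le_mul_of_nonneg_left hprod hS0
    have h2 : (((N.smoothNumbersUpTo (M + 1)).card : ℝ) + Nat.primeCounting N) * (1 / (8 * L))
        ≤ ((N : ℝ) * Real.exp (-3) / ℓ ^ 2 + Nat.primeCounting N) * (1 / (8 * L)) :=
      mul_le_mul_of_nonneg_right (by linarith only [hΨ]) (by positivity)
    have h3 : ((N : ℝ) * Real.exp (-3) / ℓ ^ 2 + Nat.primeCounting N) * (1 / (8 * L)) =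
        (N : ℝ) * Real.exp (-3) / ℓ ^ 2 * (1 / (8 * L)) +
          Nat.primeCounting N * (1 / (8 * L)) := by ring
    linarith only [h1, h2, h3, hA, hB', hM', hπz, hπQ, hW0]
  exact ErdosRankin.residueClassesCover_of_count hKM hMQ hNQK hcount

/-- **`Y(z) ≥ L(z) · z` with Rankin's `L(z) = ⌊log z · log₃ z/(672 (log₂ z)²)⌋`** for all large `z`
(MV Lemma 7.13 with the `z`-dependent `L` of the proof of Theorem 7.15).
[cite: MontgomeryVaughan2007, Theorem 7.15 (proof)] [cite: Rankin1938, Theorem] -/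
theorem residueClassesCover_rankin :
    ∀ᶠ z : ℕ in atTop, ResidueClassesCover z
      (⌊Real.log z * Real.log (Real.log (Real.log z)) / (672 * (Real.log (Real.log z)) ^ 2)⌋₊ * z) := by
  filter_upwards [eventually_growth, eventually_pnt_bounds, eventually_ge_atTop 3]
    with z hg hpnt hz3
  obtain ⟨h12, hB⟩ := hg
  obtain ⟨hπN, hπz, hπQ⟩ := hpnt
  exact cover_of_params
    (L := ⌊Real.log z * Real.log (Real.log (Real.log z)) / (672 * (Real.log (Real.log z)) ^ 2)⌋₊)
    (K := 2 * ⌊Real.log z * Real.log (Real.log (Real.log z)) /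
      (672 * (Real.log (Real.log z)) ^ 2)⌋₊ + 1)
    hz3 rfl rfl rfl rfl rfl rfl rfl h12 hB hπN hπz hπQ

/-! ### Rankin's theorem -/

/-- The gap for one `X`, all parameters explicit (`t = log₂ X`, `s = log₃ X`, `r = log₄ X`).
[folklore] -/
private theorem gap_of_params {X ℓ ℓ₂ ℓ₃ t s r : ℝ} {z L : ℕ} (hz : z = ⌊Real.log X / 3⌋₊)
    (hℓ : ℓ = Real.log z) (hℓ₂ : ℓ₂ = Real.log ℓ) (hℓ₃ : ℓ₃ = Real.log ℓ₂)
    (hL : L = ⌊ℓ * ℓ₃ / (672 * ℓ₂ ^ 2)⌋₊)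
    (ht : t = Real.log (Real.log X)) (hs : s = Real.log t) (hr : r = Real.log s)
    (hcovX : ResidueClassesCover z (L * z)) (hz3 : 3 ≤ z) (h12 : Real.exp 12 ≤ ℓ₂)
    (hB : (Real.exp 48 + 2) * 672 * ℓ₂ ^ 2 ≤ ℓ) (hoT : Real.log t ^ 2 ≤ 1 / 3840 * t)
    (hoX : Real.log X ^ 2 ≤ 1 / 8 * X) (hlinX : Real.log X ≤ 1 / 8 * X) (hT3 : 3 ≤ t)
    (hr2 : 2 ≤ r) (hX16 : 16 ≤ X) (hX12 : Real.exp 12 ≤ X) :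
    HasPrimeGap X (1 / 21504 * rankinRate X) := by
  obtain ⟨hL1, -, -, hLle, hLℓ, -, -, -, hℓ₃12⟩ := params h12 hB hℓ₂ hℓ₃ hL
  have hXpos : 0 < X := by linarith
  have hlogX12 : 12 ≤ Real.log X := by
    have := Real.log_le_log (Real.exp_pos 12) hX12
    rwa [Real.log_exp] at this
  have hlogXpos : 0 < Real.log X := by linarith
  have ht0 : 0 < t := by linarith
  -- `s ≥ 1`, `s ≥ r`, `r ≥ 2`
  have hsr : r ≤ s - 1 := by
    have hs1 : 1 < s := by
      rw [hs, ← Real.exp_lt_exp, Real.exp_log ht0]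
      have := Real.exp_one_lt_d9; linarith
    rw [hr]; exact Real.log_le_sub_one_of_pos (by linarith)
  have hs3 : 3 ≤ s := by linarith
  have hs0 : 0 < s := by linarith
  have hr0 : 0 < r := by linarith
  have hzr : (3 : ℝ) ≤ z := by exact_mod_cast hz3
  have hz0 : (0 : ℝ) < z := by linarith
  have hzle : (z : ℝ) ≤ Real.log X / 3 := by rw [hz]; exact Nat.floor_le (by positivity)
  have hzge : Real.log X / 3 - 1 < z := by rw [hz]; exact Nat.sub_one_lt_floor _
  have hz4 : Real.log X / 4 ≤ z := by linarith
  -- `ℓ ≥ t/2`, `ℓ ≤ t`, `ℓ₂ ≤ s`, `ℓ₂ ≥ s/2`, `ℓ₃ ≥ r/2`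
  have hlog4 : Real.log 4 ≤ 3 / 2 := by
    rw [show (4 : ℝ) = 2 ^ 2 by norm_num, Real.log_pow]
    have := Real.log_two_lt_d9; norm_num at this ⊢; linarith
  have hlog2 : Real.log 2 ≤ 1 := by
    have := Real.log_two_lt_d9; norm_num at this; linarith
  have hℓge : t / 2 ≤ ℓ := by
    have h1 : Real.log (Real.log X / 4) ≤ ℓ := by
      rw [hℓ]; exact Real.log_le_log (by positivity) hz4
    rw [Real.log_div hlogXpos.ne' (by norm_num), ← ht] at h1
    linarith
  have hℓle : ℓ ≤ t := by
    rw [hℓ, ht]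
    exact Real.log_le_log hz0 (by linarith)
  have hℓ0 : 0 < ℓ := by linarith
  have he12 : (12 : ℝ) + 1 ≤ Real.exp 12 := Real.add_one_le_exp 12
  have hℓ₂0 : 0 < ℓ₂ := by linarith
  have hℓ₂le : ℓ₂ ≤ s := by rw [hℓ₂, hs]; exact Real.log_le_log hℓ0 hℓle
  have hℓ₂ge : s / 2 ≤ ℓ₂ := by
    have h1 : Real.log (t / 2) ≤ ℓ₂ := by rw [hℓ₂]; exact Real.log_le_log (by positivity) hℓge
    rw [Real.log_div ht0.ne' (by norm_num), ← hs] at h1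
    linarith
  have hℓ₃ge : r / 2 ≤ ℓ₃ := by
    have h1 : Real.log (s / 2) ≤ ℓ₃ := by rw [hℓ₃]; exact Real.log_le_log (by positivity) hℓ₂ge
    rw [Real.log_div hs0.ne' (by norm_num), ← hr] at h1
    linarith
  have hℓ₃0 : 0 < ℓ₃ := by linarith
  -- `3840 s² ≤ t`, hence `t r/(5376 s²) ≥ 1`
  have hst : 3840 * s ^ 2 ≤ t := by rw [hs]; linarith
  -- `L ≥ t r/(5376 s²)`
  have hLge : t * r / (5376 * s ^ 2) ≤ (L : ℝ) := by
    have hLr : ℓ * ℓ₃ / (672 * ℓ₂ ^ 2) - 1 < L := by rw [hL]; exact Nat.sub_one_lt_floor _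
    have h1 : t * r / (2688 * s ^ 2) ≤ ℓ * ℓ₃ / (672 * ℓ₂ ^ 2) := by
      rw [div_le_div_iff₀ (by positivity) (by positivity)]
      have h2 : ℓ₂ ^ 2 ≤ s ^ 2 := pow_le_pow_left₀ hℓ₂0.le hℓ₂le 2
      have h3 : t * r ≤ (2 * ℓ) * (2 * ℓ₃) :=
        mul_le_mul (by linarith) (by linarith) hr0.le (by linarith)
      calc t * r * (672 * ℓ₂ ^ 2) ≤ (2 * ℓ) * (2 * ℓ₃) * (672 * s ^ 2) := by gcongr
        _ = ℓ * ℓ₃ * (2688 * s ^ 2) := by ring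
    have h2 : 1 ≤ t * r / (5376 * s ^ 2) := by
      rw [le_div_iff₀ (by positivity)]; nlinarith
    have h3 : t * r / (2688 * s ^ 2) = 2 * (t * r / (5376 * s ^ 2)) := by
      field_simp; ring
    linarith
  -- the gap supplied by the cover
  have hLz1 : 1 ≤ L * z := le_trans (by omega : 1 ≤ z) (Nat.le_mul_of_pos_left z hL1)
  have hgap := hasPrimeGap_of_cover hcovX hLz1
  refine hgap.mono ?_ ?_
  · -- `2 (z + P(z) + L z) ≤ X`
    have hprim : ((primorial z : ℕ) : ℝ) ≤ Real.sqrt X := by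
      have h4 : ((primorial z : ℕ) : ℝ) ≤ (4 : ℝ) ^ (z : ℝ) := by
        rw [Real.rpow_natCast]; exact_mod_cast primorial_le_four_pow z
      refine h4.trans ?_
      rw [Real.sqrt_eq_rpow, Real.rpow_def_of_pos (by norm_num : (0 : ℝ) < 4),
        Real.rpow_def_of_pos hXpos, Real.exp_le_exp]
      calc Real.log 4 * (z : ℝ) ≤ 3 / 2 * (Real.log X / 3) := by gcongr
        _ = Real.log X * (1 / 2) := by ring
    have hsqrt : Real.sqrt X ≤ X / 4 := by
      have h16 : Real.sqrt 16 = 4 := by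
        rw [show (16 : ℝ) = 4 ^ 2 by norm_num, Real.sqrt_sq (by norm_num)]
      have h4 : 4 ≤ Real.sqrt X := h16 ▸ Real.sqrt_le_sqrt hX16
      have h5 := Real.mul_self_sqrt hXpos.le
      have h6 := mul_le_mul_of_nonneg_right h4 (Real.sqrt_nonneg X)
      linarith only [h5, h6]
    have hLt : (L : ℝ) ≤ Real.log X := hLℓ.trans (hℓle.trans (by
      rw [ht]; exact (Real.log_le_sub_one_of_pos hlogXpos).trans (by linarith)))
    have hN : (L : ℝ) * z ≤ Real.log X ^ 2 :=
      calc (L : ℝ) * z ≤ Real.log X * (Real.log X / 3) := mul_le_mul hLt hzle hz0.le hlogXpos.le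
        _ ≤ Real.log X ^ 2 := by
            rw [sq]; exact mul_le_mul_of_nonneg_left (by linarith only [hlogXpos]) hlogXpos.le
    have hzX : (z : ℝ) ≤ 1 / 8 * X := by linarith
    push_cast
    linarith only [hzX, hprim, hsqrt, hN, hoX, hlinX]
  · -- `(1/21504) · rankinRate X ≤ L z + 1`
    have i2 : Real.log^[2] X = t := by
      rw [ht]; simp [Function.iterate_succ_apply']
    have i3 : Real.log^[3] X = s := by
      rw [hs, ht]; simp [Function.iterate_succ_apply']
    have i4 : Real.log^[4] X = r := by
      rw [hr, hs, ht]; simp [Function.iterate_succ_apply']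
    rw [rankinRate, i2, i3, i4]
    push_cast
    have h1 : 1 / 21504 * (Real.log X * t * r / s ^ 2) =
        t * r / (5376 * s ^ 2) * (Real.log X / 4) := by
      field_simp; ring
    rw [h1]
    have hLz : t * r / (5376 * s ^ 2) * (Real.log X / 4) ≤ (L : ℝ) * z :=
      mul_le_mul hLge hz4 (by positivity) (by positivity)
    linarith

open Asymptotics in
/-- For all large `X`, `G(X) ≥ rankinRate X / 21504`. [cite: Rankin1938, Theorem]
[cite: MontgomeryVaughan2007, Theorem 7.15] -/
theorem eventually_hasPrimeGap_rankinRate :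
    ∀ᶠ X : ℝ in atTop, HasPrimeGap X (1 / 21504 * rankinRate X) := by
  have hz : Tendsto (fun X : ℝ => ⌊Real.log X / 3⌋₊) atTop atTop :=
    tendsto_nat_floor_atTop.comp (Real.tendsto_log_atTop.atTop_div_const (by norm_num))
  have hT₂ : Tendsto (fun X : ℝ => Real.log (Real.log X)) atTop atTop :=
    Real.tendsto_log_atTop.comp Real.tendsto_log_atTop
  have hT₄ : Tendsto (fun X : ℝ => Real.log (Real.log (Real.log (Real.log X)))) atTop atTop :=
    Real.tendsto_log_atTop.comp (Real.tendsto_log_atTop.comp hT₂)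
  have ho := (Real.isLittleO_pow_log_id_atTop (n := 2)).bound (show (0 : ℝ) < 1 / 3840 by norm_num)
  have hoX := (Real.isLittleO_pow_log_id_atTop (n := 2)).bound (show (0 : ℝ) < 1 / 8 by norm_num)
  have hlin := Real.isLittleO_log_id_atTop.bound (show (0 : ℝ) < 1 / 8 by norm_num)
  filter_upwards [hz.eventually residueClassesCover_rankin, hz.eventually (eventually_ge_atTop 3),
    hz.eventually eventually_growth, hT₂.eventually ho, hoX, hlin,
    hT₂.eventually_ge_atTop 3, hT₄.eventually_ge_atTop 2, eventually_ge_atTop (16 : ℝ),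
    eventually_ge_atTop (Real.exp 12)]
    with X hcovX hz3 hgz hoT hoX' hlinX hT3 hr2 hX16 hX12
  obtain ⟨h12, hB⟩ := hgz
  have hXpos : 0 < X := by linarith
  have hlogXpos : 0 < Real.log X := Real.log_pos (by linarith)
  have ht0 : 0 < Real.log (Real.log X) := by linarith
  rw [Real.norm_eq_abs, Real.norm_eq_abs, id, abs_of_nonneg (by positivity),
    abs_of_nonneg ht0.le] at hoT
  rw [Real.norm_eq_abs, Real.norm_eq_abs, id, abs_of_nonneg (by positivity),
    abs_of_pos hXpos] at hoX'
  rw [Real.norm_eq_abs, Real.norm_eq_abs, id, abs_of_pos hlogXpos, abs_of_pos hXpos] at hlinX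
  exact gap_of_params rfl rfl rfl rfl rfl rfl rfl rfl hcovX hz3 h12 hB hoT hoX' hlinX hT3 hr2
    hX16 hX12

/-- `rankinRate X ≥ 0` for all large `X`. [folklore] -/
private theorem eventually_rankinRate_nonneg : ∀ᶠ X : ℝ in atTop, 0 ≤ rankinRate X := by
  have hT₂ : Tendsto (fun X : ℝ => Real.log (Real.log X)) atTop atTop :=
    Real.tendsto_log_atTop.comp Real.tendsto_log_atTop
  have hT₄ : Tendsto (fun X : ℝ => Real.log (Real.log (Real.log (Real.log X)))) atTop atTop :=
    Real.tendsto_log_atTop.comp (Real.tendsto_log_atTop.comp hT₂)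
  filter_upwards [Real.tendsto_log_atTop.eventually_ge_atTop 0, hT₂.eventually_ge_atTop 0,
    hT₄.eventually_ge_atTop 0] with X h1 h2 h4
  have i2 : Real.log^[2] X = Real.log (Real.log X) := by simp [Function.iterate_succ_apply']
  have i4 : Real.log^[4] X = Real.log (Real.log (Real.log (Real.log X))) := by
    simp [Function.iterate_succ_apply']
  rw [rankinRate, i2, i4]
  positivity

/-- **Rankin's constant `c = 1/21504` is admissible**: `RankinConstant (1/21504)`.
[cite: Rankin1938, Theorem] [cite: MontgomeryVaughan2007, Theorem 7.15] -/
theorem rankinConstant_holds : RankinConstant (1 / 21504) := by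
  intro ε hε
  filter_upwards [eventually_hasPrimeGap_rankinRate, eventually_rankinRate_nonneg] with X hX hr
  exact hX.mono le_rfl (by nlinarith)

/-- **Rankin 1938 / Montgomery–Vaughan Theorem 7.15 — PROVED**: there is a constant `c > 0`
(here `c = 1/21504`) such that for every `ε > 0` and all large `X` there are consecutive primes
`p_n < p_{n+1} ≤ X` with `p_{n+1} − p_n ≥ (c − ε) · log X · log₂ X · log₄ X/(log₃ X)²`. This
discharges the named fact `Rankin1938_existsConstant` (the ladder's designated formalisation target)
in its typed `G(X)` form; see the module docstring for the relation to MV's `limsup` display.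
[cite: MontgomeryVaughan2007, Theorem 7.15] [cite: Rankin1938, Theorem]
[cite: FordGreenKonyaginTao2016, p. 936] -/
theorem rankin1938_existsConstant_holds : Rankin1938_existsConstant :=
  ⟨1 / 21504, by norm_num, rankinConstant_holds⟩

end Rankin38

/-- Re-export: **Rankin's theorem** `∃ c > 0, G(X) ≥ (c + o(1)) log X log₂ X log₄ X/(log₃ X)²`
(named fact `Rankin1938_existsConstant`, Montgomery–Vaughan Theorem 7.15) holds.
[cite: MontgomeryVaughan2007, Theorem 7.15] [cite: Rankin1938, Theorem] -/
theorem rankin1938_existsConstant_holds : Rankin1938_existsConstant :=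
  Rankin38.rankin1938_existsConstant_holds

/-- Consistency: the proved Rankin theorem re-derives the (independently proved) Erdős and
Westzynthius facts through the chain of `LargeGapsBetweenPrimes.lean`. [folklore] -/
example : Erdos1935_largeGaps := erdos1935_of_rankin1938_existsConstant rankin1938_existsConstant_holds

end Literature.NumberTheory.Sieve
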